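import Literature.NumberTheory.LFunctions.WeilMarkovQuadratic
import Literature.NumberTheory.LFunctions.WeilExplicitArchTermParityProofs
import HarnessLib

/-!
# The twisted Markov decomposition of Weil's functional for `L(s, χ)`

Sibling of `WeilMarkovQuadratic.lean` (the case `L = ζ`: `Re Q(g) = P(g) + 𝓔_a(g) − M_a‖g‖₂²` on the
window `[-a, a]`, Bombieri 2000 Thm. 2 read through the increments `D_t(g) = ∫|g(x+t) − g(x)|²dx`) and
of `WeilExplicitDirichlet.lean` (Weil's (11) for `k = ℚ` and a Dirichlet character `χ` mod `q`:
`Q_χ(g) = W_χ(g ⋆ g̃)`, `W_χ = δ_{q,1}·(polar) − P_χ + A_{q,a_χ}`).  For EVERY Dirichlet character `χ`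
mod `q` (any parity `κ = a_χ`, complex values allowed, primitivity not needed) and every test function
`g` supported in `[-a, a]`:

  `Re Q_χ(g) = δ_{q,1} P(g) + 𝓔^χ_a(g) − M^χ_a ‖g‖₂²`        (`re_weilQuadraticChar_eq_markov`)

with

* the **twisted pure-jump Dirichlet form**
  `𝓔^χ_a(g) = Σ_{log n < 2a} Λ(n) n^{-1/2} D^{χ̄(n)}_{log n}(g) + ∫₀^∞ e^{(1/2−κ)t}/(2 sinh t) D_t(g) dt ≥ 0`,
  where `D^ω_t(g) = ∫ |g(x + t) − ω g(x)|² dx` is the increment TWISTED by the unit `ω` (`D^1 = D`;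
  for `χ(n) = 0` the jump degenerates to `D^0_t(g) = ‖g‖₂²`): the character sits entirely in the phases
  of the jumps at the prime-power lengths `log n`, and the parity only lowers the archimedean jump
  density (`e^{−t/2}/(2 sinh t) ≤ e^{t/2}/(2 sinh t)`);
* the **twisted killing constant**
  `M^χ_a = Σ_{log n < 2a} Λ(n) n^{-1/2}(1 + |χ(n)|²) + 2∫₀^∞ (e^{(1/2−κ)t} − 1) dt/(2 sinh t) + log 4π + γ − log q`,
  which sees `χ` only through `|χ(n)| ∈ {0, 1}` (i.e. through `gcd(n, q)`), the parity and `log q`.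

The proof is the `ζ` one with two changes: the kernel identity becomes the TWISTED polarisation
`ω k(t) + ω̄ k(−t) = 2 Re(ω k(t)) = (1 + |ω|²)‖g‖₂² − D^{ω̄}_t(g)` (`k = g ⋆ g̃`, `k(−t) = conj k(t)`;
`mul_weilConv_weilReflect_add_conj_mul_neg`), inserted in Weil's prime term
`Σ Λ(n)n^{-1/2}[χ(n)k(log n) + χ̄(n)k(−log n)]`, and the archimedean term is taken in the position form
with parity, `(1/2π)·weilArchIntegralChar κ k = −(log 4 + γ)k(0) − ∫₀^∞ (e^{(1/2−κ)x}(k(x)+k(−x)) − 2k(0))dx/(2 sinh x)`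
(`WeilArchParity.weilArchIntegralChar_eq_position`, Bombieri (2.8) with `w = (s+κ)/2`).  At modulus `1`
everything reduces literally to the `ζ` file (`weilDirichletEnergyChar_modOne`,
`weilMarkovConstantChar_modOne`).  Everything is proved; no named facts.

Consumers (cell rh-explicit, GRH arm): the comparison `Q_χ − Q_ζ` term by term (transfer of `ζ` rungs to
`L(s, χ)`), and the window-form / Gram dictionary for `χ`-twisted Fourier–Galerkin certificates, which
evaluate exactly `𝓔^χ_a − M^χ_a‖·‖²` on trigonometric windows.

## References

* A. Weil, *Sur les "formules explicites" de la théorie des nombres premiers*, Comm. Sém. Math. Univ.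
  Lund (1952) 252–265, (11) pp. 261–262. [Weil1952FormulesExplicites]
* E. Bombieri, *Remarks on Weil's quadratic functional in the theory of prime numbers I*, Rend. Mat.
  Acc. Lincei (9) 11 (2000) 183–233, Thm. 2 p. 193 and §2 (2.8). [Bombieri2000Weil]
* Z.-Q. Chen, M. Fukushima, *Symmetric Markov Processes, Time Change, and Boundary Theory*, Princeton
  2012, §1.1 (pure-jump Dirichlet forms). [ChenFukushima2012]
-/

noncomputable section

open Complex Filter Set MeasureTheory
open scoped Real Topology ComplexConjugate ArithmeticFunction.vonMangoldt

namespace Literature.NumberTheory.LFunctions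

variable {q : ℕ} {g : ℝ → ℂ}

/-! ## Definitions -/

/-- The **twisted increment** `D^ω_t(g) = ∫ |g(x + t) − ω g(x)|² dx` (`ω ∈ ℂ`; `D^1_t = D_t` is the
increment form `weilIncrement`, `D^0_t(g) = ‖g‖₂²`).  For `k = g ⋆ g̃` and `|ω| = 1`,
`2 Re(ω̄ k(t)) = 2‖g‖₂² − D^ω_t(g)` (`mul_weilConv_weilReflect_add_conj_mul_neg`): the jump form through
which the `χ(n)`-weighted prime term of Weil's (11) is a Dirichlet-type form.
[cite: Bombieri2000Weil, Thm 2 (p. 193), prime term read through increments; Weil1952FormulesExplicites, (11) pp. 261–262] -/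
def weilTwistIncrement (ω : ℂ) (g : ℝ → ℂ) (t : ℝ) : ℝ :=
  ∫ x : ℝ, ‖g (x + t) - ω * g x‖ ^ 2

/-- The **archimedean jump density of parity `κ`**: `ρ_κ(t) = e^{(1/2−κ)t}/(2 sinh t)` (`κ = 0`:
Bombieri's `x dx/(x²−1)`, `x = eᵗ`, i.e. `weilArchDensity`; `κ = 1`: the odd real place, Weil's kernel
`K_{1,1}` in place of `K_{1,0}`). [cite: Weil1952FormulesExplicites, (11) p. 262 (K_{1,f}); Bombieri2000Weil, §2 (2.8)] -/
def weilArchDensityPar (κ : ℕ) (t : ℝ) : ℝ :=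
  Real.exp ((1 / 2 - κ) * t) / (2 * Real.sinh t)

/-- The **killing density of parity `κ`**: `(e^{(1/2−κ)t} − 1)/(2 sinh t)` (the coefficient of
`2‖g‖₂²` in Bombieri's integrand with parity; `κ = 0` is the `ζ` file's killing density).
[cite: Bombieri2000Weil, §2 (2.8)] -/
def weilKillingDensityPar (κ : ℕ) (t : ℝ) : ℝ :=
  (Real.exp ((1 / 2 - κ) * t) - 1) / (2 * Real.sinh t)

/-- The **twisted pure-jump Dirichlet form of the window `[-a, a]` for `χ`**:
`𝓔^χ_a(g) = Σ_{log n < 2a} Λ(n) n^{-1/2} D^{χ̄(n)}_{log n}(g) + ∫₀^∞ e^{(1/2−κ)t}/(2 sinh t) D_t(g) dt`,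
`κ = a_χ` the parity: non-negative jump rates, jumps twisted by the phases `χ̄(n)`, parity-lowered
archimedean density.  At modulus `1` it is `weilDirichletEnergy a` (`weilDirichletEnergyChar_modOne`).
[cite: Weil1952FormulesExplicites, (11) pp. 261–262; Bombieri2000Weil, Thm 2 (p. 193)] -/
def weilDirichletEnergyChar (χ : DirichletCharacter ℂ q) (a : ℝ) (g : ℝ → ℂ) : ℝ :=
  (∑ n ∈ weilPrimeIndex a, (Λ n : ℝ) / Real.sqrt n *
      weilTwistIncrement (conj (χ (n : ZMod q))) g (Real.log n)) +
    ∫ t in Ioi (0 : ℝ), weilArchDensityPar (charParity χ) t * weilIncrement g t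

/-- The **twisted killing constant of the window `[-a, a]` for `χ` mod `q`**:
`M^χ_a = Σ_{log n < 2a} Λ(n) n^{-1/2} (1 + |χ(n)|²) + 2 ∫₀^∞ (e^{(1/2−κ)t} − 1) dt/(2 sinh t) + log 4π + γ − log q`
(the coefficient of `‖g‖₂² = k(0)` collected from the twisted prime term, from the archimedean integrand
with parity and from `k(0)(log(q/π) − log 4 − γ)`).  At modulus `1` it is `weilMarkovConstant a`.
[cite: Weil1952FormulesExplicites, (11) pp. 261–262; Bombieri2000Weil, Thm 2 (p. 193)] -/
def weilMarkovConstantChar (χ : DirichletCharacter ℂ q) (a : ℝ) : ℝ :=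
  (∑ n ∈ weilPrimeIndex a, (Λ n : ℝ) / Real.sqrt n * (1 + ‖χ (n : ZMod q)‖ ^ 2)) +
    2 * (∫ t in Ioi (0 : ℝ), weilKillingDensityPar (charParity χ) t) +
    (Real.log (4 * π) + Real.eulerMascheroniConstant - Real.log q)

/-! ## The twisted increment -/

/-- `D^1_t = D_t`. [folklore] -/
@[simp] private theorem weilTwistIncrement_one (g : ℝ → ℂ) (t : ℝ) :
    weilTwistIncrement 1 g t = weilIncrement g t := by
  simp [weilTwistIncrement, weilIncrement]

/-- `D^ω_t(g) ≥ 0`. [folklore] -/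
private theorem weilTwistIncrement_nonneg (ω : ℂ) (g : ℝ → ℂ) (t : ℝ) : 0 ≤ weilTwistIncrement ω g t :=
  integral_nonneg fun _ ↦ by positivity

/-- `D^ω_t(g) = ∫ |g(u) − ω g(u − t)|² du` (substitute `x = u − t`). [folklore] -/
private theorem weilTwistIncrement_eq_integral_sub (ω : ℂ) (g : ℝ → ℂ) (t : ℝ) :
    weilTwistIncrement ω g t = ∫ u : ℝ, ‖g u - ω * g (u - t)‖ ^ 2 := by
  rw [weilTwistIncrement, ← integral_add_right_eq_self (fun u : ℝ ↦ ‖g u - ω * g (u - t)‖ ^ 2) t]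
  simp only [add_sub_cancel_right]

/-- **Twisted polarisation**: `ω z w̄ + conj(ω z w̄) = |z|² + |ω|²|w|² − |z − ω̄ w|²`. [folklore] -/
private theorem mul_mul_conj_add_conj_eq (ω z w : ℂ) :
    ω * (z * conj w) + conj (ω * (z * conj w)) =
      ((‖z‖ ^ 2 + ‖ω‖ ^ 2 * ‖w‖ ^ 2 - ‖z - conj ω * w‖ ^ 2 : ℝ) : ℂ) := by
  rw [Complex.add_conj, norm_sub_sq_complex]
  congr 1
  have h1 : z * conj (conj ω * w) = ω * (z * conj w) := by
    rw [map_mul, Complex.conj_conj]; ring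
  rw [h1, norm_mul, Complex.norm_conj]
  ring

/-- **The kernel `k = g ⋆ g̃` through twisted increments**: for a test function `g`, `ω ∈ ℂ`, `t ∈ ℝ`,
`ω k(t) + ω̄ k(−t) = (1 + |ω|²)‖g‖₂² − D^{ω̄}_t(g)`
(`k(−t) = conj k(t)`, `k(t) = ∫ g(u) conj g(u−t) du`, twisted polarisation under the integral).  With
`ω = χ(n)`, `t = log n` this is the `n`-th term of Weil's twisted prime sum.
[cite: Weil1952FormulesExplicites, (11) pp. 261–262 (prime term); Bombieri2000Weil, Thm 2 (p. 193)] -/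
theorem mul_weilConv_weilReflect_add_conj_mul_neg (hg : IsWeilTest g) (ω : ℂ) (t : ℝ) :
    ω * weilConv g (weilReflect g) t + conj ω * weilConv g (weilReflect g) (-t) =
      (((1 + ‖ω‖ ^ 2) * (∫ x : ℝ, ‖g x‖ ^ 2) - weilTwistIncrement (conj ω) g t : ℝ) : ℂ) := by
  have hgc : Continuous g := hg.1.continuous
  have h2 : Integrable fun u : ℝ ↦ ‖g u‖ ^ 2 := hg.integrable_norm_sq
  have h2' : Integrable fun u : ℝ ↦ ‖ω‖ ^ 2 * ‖g (u - t)‖ ^ 2 := (h2.comp_sub_right t).const_mul _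
  have hD : Integrable fun u : ℝ ↦ ‖g u - conj ω * g (u - t)‖ ^ 2 := by
    have hm : MemLp g 2 volume := hg.memLp_two
    have htr : MemLp (fun u : ℝ ↦ g (u - t)) 2 volume :=
      hm.comp_measurePreserving (measurePreserving_sub_right volume t)
    have hsub : MemLp (fun u : ℝ ↦ g u - conj ω * g (u - t)) 2 volume := hm.sub (htr.const_mul _)
    exact (memLp_two_iff_integrable_sq_norm hsub.1).1 hsub
  have h22 : Integrable fun u : ℝ ↦ ‖g u‖ ^ 2 + ‖ω‖ ^ 2 * ‖g (u - t)‖ ^ 2 := h2.add h2'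
  have hI : Integrable fun u : ℝ ↦ g u * conj (g (u - t)) :=
    (hgc.mul (Complex.continuous_conj.comp (hgc.comp (continuous_sub_right t)))).integrable_of_hasCompactSupport
      hg.2.mul_right
  have hIc : Integrable fun u : ℝ ↦ conj (g u * conj (g (u - t))) := by
    have := Complex.conjCLE.toContinuousLinearMap.integrable_comp hI
    simpa using this
  have hk : weilConv g (weilReflect g) t = ∫ u : ℝ, g u * conj (g (u - t)) := by
    rw [weilConv_apply]
    congr 1 with u
    simp [weilReflect, neg_sub]
  rw [weilConv_weilReflect_neg, hk, ← integral_conj, ← integral_const_mul, ← integral_const_mul,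
    ← integral_add (hI.const_mul ω) (hIc.const_mul _)]
  have hpt : ∀ u : ℝ, ω * (g u * conj (g (u - t))) + conj ω * conj (g u * conj (g (u - t))) =
      ((‖g u‖ ^ 2 + ‖ω‖ ^ 2 * ‖g (u - t)‖ ^ 2 - ‖g u - conj ω * g (u - t)‖ ^ 2 : ℝ) : ℂ) := by
    intro u
    rw [← mul_mul_conj_add_conj_eq ω (g u) (g (u - t))]
    simp only [map_mul, Complex.conj_conj]
  simp_rw [hpt]
  rw [integral_complex_ofReal, integral_sub h22 hD, integral_add h2 h2', integral_const_mul,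
    integral_sub_right_eq_self (fun u : ℝ ↦ ‖g u‖ ^ 2) t, weilTwistIncrement_eq_integral_sub]
  push_cast
  ring

/-! ## The archimedean densities with parity -/

/-- `ρ_0 = weilArchDensity`. [folklore] -/
@[simp] private theorem weilArchDensityPar_zero : weilArchDensityPar 0 = weilArchDensity := by
  funext t
  simp only [weilArchDensityPar, weilArchDensity, Nat.cast_zero, sub_zero, one_div_mul_eq_div]

/-- The killing density of parity `0` is the `ζ` file's `(e^{t/2} − 1)/(2 sinh t)`. [folklore] -/
@[simp] private theorem weilKillingDensityPar_zero (t : ℝ) :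
    weilKillingDensityPar 0 t = (Real.exp (t / 2) - 1) / (2 * Real.sinh t) := by
  simp only [weilKillingDensityPar, Nat.cast_zero, sub_zero, one_div_mul_eq_div]

/-- `ρ_κ(t) > 0` for `t > 0`. [folklore] -/
private theorem weilArchDensityPar_pos (κ : ℕ) {t : ℝ} (ht : 0 < t) : 0 < weilArchDensityPar κ t :=
  div_pos (Real.exp_pos _) (mul_pos two_pos (Real.sinh_pos_iff.2 ht))

/-- **Parity lowers the archimedean density**: `ρ_κ(t) ≤ ρ_0(t)` for `t > 0`. [folklore] -/
private theorem weilArchDensityPar_le (κ : ℕ) {t : ℝ} (ht : 0 < t) :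
    weilArchDensityPar κ t ≤ weilArchDensity t := by
  unfold weilArchDensityPar weilArchDensity
  have h2s : 0 < 2 * Real.sinh t := mul_pos two_pos (Real.sinh_pos_iff.2 ht)
  refine div_le_div_of_nonneg_right (Real.exp_le_exp.2 ?_) h2s.le
  have hκ : (0 : ℝ) ≤ κ := κ.cast_nonneg
  nlinarith

/-- `|e^{(1/2−κ)t} − 1| ≤ e^{t/2} − 1` for `t ≥ 0`, `κ ≤ 1` (for `κ = 1`:
`1 − e^{−t/2} ≤ e^{t/2} − 1` since `e^{t/2} + e^{−t/2} ≥ 2`). [folklore] -/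
private theorem abs_exp_par_sub_one_le {κ : ℕ} (hκ : κ ≤ 1) {t : ℝ} (ht : 0 ≤ t) :
    |Real.exp ((1 / 2 - κ) * t) - 1| ≤ Real.exp (t / 2) - 1 := by
  interval_cases κ
  · simp only [Nat.cast_zero, sub_zero, one_div_mul_eq_div]
    exact le_of_eq (abs_of_nonneg (sub_nonneg.2 (Real.one_le_exp (by positivity))))
  · have e : ((1 : ℝ) / 2 - ((1 : ℕ) : ℝ)) * t = -(t / 2) := by push_cast; ring
    rw [e]
    have h1 : Real.exp (-(t / 2)) ≤ 1 := Real.exp_le_one_iff.2 (by linarith)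
    have hprod : Real.exp (t / 2) * Real.exp (-(t / 2)) = 1 := by
      rw [← Real.exp_add, add_neg_cancel, Real.exp_zero]
    rw [abs_of_nonpos (by linarith)]
    nlinarith [Real.exp_pos (t / 2), Real.exp_pos (-(t / 2)),
      sq_nonneg (Real.exp (t / 2) - 1), sq_nonneg (Real.exp (-(t/2)) - 1)]

/-- `|(e^{(1/2−κ)t} − 1)/(2 sinh t)| ≤ e^{−t/2}` on `(0, ∞)` for `κ ≤ 1`. [folklore] -/
private theorem abs_weilKillingDensityPar_le {κ : ℕ} (hκ : κ ≤ 1) {t : ℝ} (ht : 0 < t) :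
    |weilKillingDensityPar κ t| ≤ Real.exp (-(1 / 2) * t) := by
  have h2s : 0 < 2 * Real.sinh t := mul_pos two_pos (Real.sinh_pos_iff.2 ht)
  rw [weilKillingDensityPar, abs_div, abs_of_pos h2s]
  calc |Real.exp ((1 / 2 - κ) * t) - 1| / (2 * Real.sinh t)
      ≤ (Real.exp (t / 2) - 1) / (2 * Real.sinh t) :=
        div_le_div_of_nonneg_right (abs_exp_par_sub_one_le hκ ht.le) h2s.le
    _ ≤ Real.exp (-(1 / 2) * t) := weilKillingDensity_le ht

/-- **The killing integral with parity converges** (`κ ≤ 1`). [folklore] -/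
private theorem integrableOn_weilKillingDensityPar {κ : ℕ} (hκ : κ ≤ 1) :
    IntegrableOn (weilKillingDensityPar κ) (Ioi 0) := by
  refine Integrable.mono' (exp_neg_integrableOn_Ioi 0 (by norm_num : (0 : ℝ) < 1 / 2)) ?_ ?_
  · exact ((by fun_prop : Continuous fun t : ℝ ↦ Real.exp ((1 / 2 - κ) * t) - 1).measurable.div
      (by fun_prop : Continuous fun t : ℝ ↦ 2 * Real.sinh t).measurable).aestronglyMeasurable
  · refine (ae_restrict_iff' measurableSet_Ioi).2 (Eventually.of_forall fun t (ht : 0 < t) ↦ ?_)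
    rw [Real.norm_eq_abs]
    exact abs_weilKillingDensityPar_le hκ ht

/-- The increments of a test function as a function of the length: `D_t(g) = 2‖g‖₂² − Re(k(t) + k(−t))`,
`k = g ⋆ g̃`. [folklore] -/
private theorem weilIncrement_eq_sub_re_aux (hg : IsWeilTest g) (t : ℝ) :
    weilIncrement g t = 2 * (∫ x : ℝ, ‖g x‖ ^ 2) -
      (weilConv g (weilReflect g) t + weilConv g (weilReflect g) (-t)).re := by
  have h := congrArg Complex.re (weilConv_weilReflect_add_neg hg t)
  rw [Complex.ofReal_re] at h
  linarith

/-- `t ↦ D_t(g)` is continuous for a test function `g` (`k = g ⋆ g̃` is continuous). [folklore] -/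
private theorem continuous_weilIncrement_aux (hg : IsWeilTest g) : Continuous fun t : ℝ ↦ weilIncrement g t := by
  have hkc : Continuous (weilConv g (weilReflect g)) := (hg.weilConv hg.weilReflect).1.continuous
  have e : (fun t : ℝ ↦ weilIncrement g t) = fun t ↦ 2 * (∫ x : ℝ, ‖g x‖ ^ 2) -
      (weilConv g (weilReflect g) t + weilConv g (weilReflect g) (-t)).re :=
    funext (weilIncrement_eq_sub_re_aux hg)
  rw [e]
  fun_prop

/-- **Test functions have finite twisted energy**: `t ↦ ρ_κ(t) D_t(g)` is integrable on `(0, ∞)`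
(`0 ≤ ρ_κ D ≤ ρ_0 D`, and the `ζ` file's `integrableOn_weilArchDensity_mul_weilIncrement`). [folklore] -/
private theorem integrableOn_weilArchDensityPar_mul_weilIncrement (hg : IsWeilTest g) (κ : ℕ) :
    IntegrableOn (fun t : ℝ ↦ weilArchDensityPar κ t * weilIncrement g t) (Ioi 0) := by
  refine Integrable.mono' (integrableOn_weilArchDensity_mul_weilIncrement hg) ?_ ?_
  · refine ((Measurable.div ?_ ?_).mul (continuous_weilIncrement_aux hg).measurable).aestronglyMeasurable
    · exact (by fun_prop : Continuous fun t : ℝ ↦ Real.exp ((1 / 2 - κ) * t)).measurable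
    · exact (by fun_prop : Continuous fun t : ℝ ↦ 2 * Real.sinh t).measurable
  · refine (ae_restrict_iff' measurableSet_Ioi).2 (Eventually.of_forall fun t (ht : 0 < t) ↦ ?_)
    have h0 : 0 ≤ weilIncrement g t := weilIncrement_nonneg g t
    rw [Real.norm_of_nonneg (mul_nonneg (weilArchDensityPar_pos κ ht).le h0)]
    exact mul_le_mul_of_nonneg_right (weilArchDensityPar_le κ ht) h0

/-! ## The twisted prime term through twisted increments -/

/-- **Weil's twisted prime term through twisted increments**: for a test function `g` supported in
`[-a, a]` and `k = g ⋆ g̃`,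
`Σₙ Λ(n) n^{-1/2} [χ(n) k(log n) + χ̄(n) k(−log n)] = Σ_{log n < 2a} Λ(n) n^{-1/2} [(1 + |χ(n)|²)‖g‖₂² − D^{χ̄(n)}_{log n}(g)]`
(only `log n < 2a` contributes, and term by term `mul_weilConv_weilReflect_add_conj_mul_neg`).
[cite: Weil1952FormulesExplicites, (11) pp. 261–262 (prime term); Bombieri2000Weil, Thm 2 (p. 193)] -/
theorem weilPrimeTermChar_weilConv_weilReflect (χ : DirichletCharacter ℂ q) (hg : IsWeilTest g) {a : ℝ}
    (hsupp : tsupport g ⊆ Icc (-a) a) :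
    weilPrimeTermChar χ (weilConv g (weilReflect g)) =
      ((∑ n ∈ weilPrimeIndex a, (Λ n : ℝ) / Real.sqrt n *
        ((1 + ‖χ (n : ZMod q)‖ ^ 2) * (∫ x : ℝ, ‖g x‖ ^ 2) -
          weilTwistIncrement (conj (χ (n : ZMod q))) g (Real.log n)) : ℝ) : ℂ) := by
  have hvan : ∀ n ∉ weilPrimeIndex a,
      ((Λ n : ℝ) : ℂ) / (Real.sqrt n : ℂ) * (χ (n : ZMod q) * weilConv g (weilReflect g) (Real.log n) +
        conj (χ (n : ZMod q)) * weilConv g (weilReflect g) (-Real.log n)) = 0 := by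
    intro n hn
    rw [mem_weilPrimeIndex, not_lt] at hn
    have h0 : 0 ≤ Real.log n := Real.log_natCast_nonneg n
    have h1 : weilConv g (weilReflect g) (Real.log n) = 0 :=
      weilConv_weilReflect_eq_zero_of_le_abs hg hsupp (by rwa [abs_of_nonneg h0])
    have h2 : weilConv g (weilReflect g) (-Real.log n) = 0 :=
      weilConv_weilReflect_eq_zero_of_le_abs hg hsupp (by rwa [abs_neg, abs_of_nonneg h0])
    rw [h1, h2, mul_zero, mul_zero, add_zero, mul_zero]
  unfold weilPrimeTermChar
  rw [tsum_eq_sum hvan]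
  push_cast
  refine Finset.sum_congr rfl fun n _ ↦ ?_
  rw [mul_weilConv_weilReflect_add_conj_mul_neg hg]
  push_cast
  ring

/-! ## The archimedean term with parity through increments -/

/-- **The archimedean term of conductor `q` and parity `κ ≤ 1` through increments**: for a test
function `g` and `k = g ⋆ g̃`,
`A_{q,κ}(k) = (log q − log π − log 4 − γ)‖g‖₂² − 2‖g‖₂² ∫₀^∞ (e^{(1/2−κ)t} − 1)dt/(2 sinh t) + ∫₀^∞ ρ_κ(t) D_t(g) dt`
(position form `WeilArchParity.weilArchIntegralChar_eq_position`, then `k(t) + k(−t) = 2‖g‖₂² − D_t(g)`,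
`k(0) = ‖g‖₂²`, and the two convergent pieces are separated).
[cite: Bombieri2000Weil, §2 (2.8); Weil1952FormulesExplicites, (11) pp. 261–262 (archimedean term, A = q/2π)] -/
theorem weilArchTermChar_weilConv_weilReflect (hg : IsWeilTest g) (q : ℕ) {κ : ℕ} (hκ : κ ≤ 1) :
    weilArchTermChar q κ (weilConv g (weilReflect g)) =
      (((Real.log q - Real.log π - Real.log 4 - Real.eulerMascheroniConstant) * (∫ x : ℝ, ‖g x‖ ^ 2) -
          2 * (∫ x : ℝ, ‖g x‖ ^ 2) * (∫ t in Ioi (0 : ℝ), weilKillingDensityPar κ t) +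
          ∫ t in Ioi (0 : ℝ), weilArchDensityPar κ t * weilIncrement g t : ℝ) : ℂ) := by
  have hk : IsWeilTest (weilConv g (weilReflect g)) := hg.weilConv hg.weilReflect
  have hpos := WeilArchParity.weilArchIntegralChar_eq_position hk hκ
  have hpt : ∀ t : ℝ,
      ((Real.exp ((1 / 2 - κ) * t) : ℂ) * (weilConv g (weilReflect g) t +
          weilConv g (weilReflect g) (-t)) - 2 * weilConv g (weilReflect g) 0) / (2 * Real.sinh t : ℂ) =
        ((2 * (∫ x : ℝ, ‖g x‖ ^ 2) * weilKillingDensityPar κ t -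
          weilArchDensityPar κ t * weilIncrement g t : ℝ) : ℂ) := by
    intro t
    rw [weilConv_weilReflect_add_neg hg, weilConv_weilReflect_apply_zero]
    unfold weilKillingDensityPar weilArchDensityPar
    push_cast
    ring
  have hint : (∫ t in Ioi (0 : ℝ), ((Real.exp ((1 / 2 - κ) * t) : ℂ) *
      (weilConv g (weilReflect g) t + weilConv g (weilReflect g) (-t)) -
        2 * weilConv g (weilReflect g) 0) / (2 * Real.sinh t : ℂ)) =
      ((2 * (∫ x : ℝ, ‖g x‖ ^ 2) * (∫ t in Ioi (0 : ℝ), weilKillingDensityPar κ t) -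
        ∫ t in Ioi (0 : ℝ), weilArchDensityPar κ t * weilIncrement g t : ℝ) : ℂ) := by
    simp_rw [hpt]
    rw [integral_complex_ofReal, integral_sub ((integrableOn_weilKillingDensityPar hκ).const_mul _)
      (integrableOn_weilArchDensityPar_mul_weilIncrement hg κ), integral_const_mul]
  have hπ : (π : ℂ) ≠ 0 := Complex.ofReal_ne_zero.2 Real.pi_ne_zero
  unfold weilArchTermChar
  rw [hpos, hint, weilConv_weilReflect_apply_zero]
  push_cast
  field_simp
  ring

/-! ## The twisted Markov decomposition -/

/-- **The twisted Markov decomposition of Weil's functional for `L(s, χ)`**: for every Dirichlet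
character `χ` mod `q` and every test function `g` with `tsupport g ⊆ [-a, a]`,

`Re Q_χ(g) = δ_{q,1} P(g) + 𝓔^χ_a(g) − M^χ_a ‖g‖₂²`,

`𝓔^χ_a = weilDirichletEnergyChar χ a` the twisted pure-jump Dirichlet form (jumps at `log n` twisted by
`χ̄(n)`, archimedean density of parity `a_χ`), `M^χ_a = weilMarkovConstantChar χ a`, and the pole form
`P = weilPoleForm` present only at modulus `1`.  (Weil's (11) for `k = ℚ` at `F = g ⋆ g̃`, read through
increments as in Bombieri's Thm. 2.)
[cite: Weil1952FormulesExplicites, (11) pp. 261–262, k = ℚ; Bombieri2000Weil, Thm 2 (p. 193)] -/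
theorem re_weilQuadraticChar_eq_markov (χ : DirichletCharacter ℂ q) (hg : IsWeilTest g) {a : ℝ}
    (hsupp : tsupport g ⊆ Icc (-a) a) :
    (weilQuadraticChar χ g).re =
      (if q = 1 then weilPoleForm g else 0) + weilDirichletEnergyChar χ a g -
        weilMarkovConstantChar χ a * ∫ x : ℝ, ‖g x‖ ^ 2 := by
  have hκ := charParity_le_one χ
  have hpol : (if q = 1 then weilPolarTerm (weilConv g (weilReflect g)) else (0 : ℂ)).re =
      (if q = 1 then weilPoleForm g else 0) := by
    split_ifs
    · exact weilPolarTerm_weilConv_weilReflect_re hg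
    · simp
  have hsum : ∑ n ∈ weilPrimeIndex a, (Λ n : ℝ) / Real.sqrt n *
      ((1 + ‖χ (n : ZMod q)‖ ^ 2) * (∫ x : ℝ, ‖g x‖ ^ 2) -
        weilTwistIncrement (conj (χ (n : ZMod q))) g (Real.log n)) =
      (∫ x : ℝ, ‖g x‖ ^ 2) *
          (∑ n ∈ weilPrimeIndex a, (Λ n : ℝ) / Real.sqrt n * (1 + ‖χ (n : ZMod q)‖ ^ 2)) -
        ∑ n ∈ weilPrimeIndex a, (Λ n : ℝ) / Real.sqrt n *
          weilTwistIncrement (conj (χ (n : ZMod q))) g (Real.log n) := by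
    rw [Finset.mul_sum, ← Finset.sum_sub_distrib]
    exact Finset.sum_congr rfl fun n _ ↦ by ring
  have hlog : Real.log (4 * π) = Real.log 4 + Real.log π :=
    Real.log_mul (by norm_num) Real.pi_ne_zero
  unfold weilQuadraticChar weilFunctionalChar
  rw [Complex.add_re, Complex.sub_re, hpol, weilPrimeTermChar_weilConv_weilReflect χ hg hsupp,
    weilArchTermChar_weilConv_weilReflect hg q hκ, Complex.ofReal_re, Complex.ofReal_re, hsum]
  unfold weilDirichletEnergyChar weilMarkovConstantChar
  rw [hlog]
  ring

/-- For `q ≠ 1` (no pole): `Re Q_χ(g) = 𝓔^χ_a(g) − M^χ_a ‖g‖₂²`.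
[cite: Weil1952FormulesExplicites, (11) pp. 261–262, δ_χ = 0] -/
theorem re_weilQuadraticChar_eq_markov_of_ne_one (hq : q ≠ 1) (χ : DirichletCharacter ℂ q)
    (hg : IsWeilTest g) {a : ℝ} (hsupp : tsupport g ⊆ Icc (-a) a) :
    (weilQuadraticChar χ g).re =
      weilDirichletEnergyChar χ a g - weilMarkovConstantChar χ a * ∫ x : ℝ, ‖g x‖ ^ 2 := by
  rw [re_weilQuadraticChar_eq_markov χ hg hsupp, if_neg hq, zero_add]

/-! ## Properties: non-negativity of the twisted energy, the coercivity floor, modulus `1` -/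

/-- **`𝓔^χ_a ≥ 0`**: non-negative rates and densities against non-negative (twisted) increments.
[cite: ChenFukushima2012, §1.1 Def. 1.1.2 (pure-jump forms are non-negative)] -/
theorem weilDirichletEnergyChar_nonneg (χ : DirichletCharacter ℂ q) (a : ℝ) (g : ℝ → ℂ) :
    0 ≤ weilDirichletEnergyChar χ a g := by
  refine add_nonneg (Finset.sum_nonneg fun n _ ↦ mul_nonneg
    (div_nonneg ArithmeticFunction.vonMangoldt_nonneg (Real.sqrt_nonneg _))
    (weilTwistIncrement_nonneg _ g _)) ?_
  exact setIntegral_nonneg measurableSet_Ioi fun t ht ↦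
    mul_nonneg (weilArchDensityPar_pos _ ht).le (weilIncrement_nonneg g t)

/-- **Coercivity floor**: for `q ≠ 1` and `g` supported in `[-a, a]`, `Re Q_χ(g) ≥ −M^χ_a ‖g‖₂²`
(drop the non-negative twisted energy). [cite: Weil1952FormulesExplicites, (11) pp. 261–262] -/
theorem neg_weilMarkovConstantChar_mul_le_re_weilQuadraticChar (hq : q ≠ 1)
    (χ : DirichletCharacter ℂ q) (hg : IsWeilTest g) {a : ℝ} (hsupp : tsupport g ⊆ Icc (-a) a) :
    -(weilMarkovConstantChar χ a * ∫ x : ℝ, ‖g x‖ ^ 2) ≤ (weilQuadraticChar χ g).re := by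
  rw [re_weilQuadraticChar_eq_markov_of_ne_one hq χ hg hsupp]
  linarith [weilDirichletEnergyChar_nonneg χ a g]

/-- A character of modulus `1` takes the value `1` everywhere. [folklore] -/
private theorem char_modOne_apply (χ : DirichletCharacter ℂ 1) (n : ℕ) : χ (n : ZMod 1) = 1 := by
  rw [Subsingleton.elim (n : ZMod 1) 1, map_one]

/-- **Consistency with the `ζ` file**: at modulus `1`, `𝓔^χ_a = 𝓔_a` (`χ ≡ 1`, parity `0`).
[cite: Bombieri2000Weil, Thm 2 (p. 193), case L = ζ] -/
theorem weilDirichletEnergyChar_modOne (χ : DirichletCharacter ℂ 1) (a : ℝ) (g : ℝ → ℂ) :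
    weilDirichletEnergyChar χ a g = weilDirichletEnergy a g := by
  unfold weilDirichletEnergyChar weilDirichletEnergy
  simp only [char_modOne_apply, map_one, weilTwistIncrement_one, charParity_modOne,
    weilArchDensityPar_zero]

/-- **Consistency with the `ζ` file**: at modulus `1`, `M^χ_a = M_a`.
[cite: Bombieri2000Weil, Thm 2 (p. 193), case L = ζ] -/
theorem weilMarkovConstantChar_modOne (χ : DirichletCharacter ℂ 1) (a : ℝ) :
    weilMarkovConstantChar χ a = weilMarkovConstant a := by
  unfold weilMarkovConstantChar weilMarkovConstant
  have hs : ∑ n ∈ weilPrimeIndex a, (Λ n : ℝ) / Real.sqrt n * (1 + ‖χ (n : ZMod 1)‖ ^ 2) =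
      2 * ∑ n ∈ weilPrimeIndex a, (Λ n : ℝ) / Real.sqrt n := by
    rw [Finset.mul_sum]
    exact Finset.sum_congr rfl fun n _ ↦ by rw [char_modOne_apply, norm_one]; ring
  have hi : (∫ t in Ioi (0 : ℝ), weilKillingDensityPar (charParity χ) t) =
      ∫ t in Ioi (0 : ℝ), (Real.exp (t / 2) - 1) / (2 * Real.sinh t) := by
    simp only [charParity_modOne, weilKillingDensityPar_zero]
  rw [hs, hi, Nat.cast_one, Real.log_one, sub_zero]

end Literature.NumberTheory.LFunctions

end
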